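import Summits.ResolutionOfSingularities.ResolutionOfSingularities.Theorems.FrobeniusClosingSteerCriticalSurface
import Summits.ResolutionOfSingularities.ResolutionOfSingularities.Theorems.FrobeniusClosingSteerJacobianThinness
import Summits.ResolutionOfSingularities.ResolutionOfSingularities.Theorems.FrobeniusClosingSteerBlowupDerivation
import HarnessLib

/-!
# Crux `Steer` (stmt-ResolutionOfSingularities-16345), chain W4.1, p = 2 σ-residual, LOW half: a SURFACE STEP EXITS (C8) —
# a step whose exceptional parameter lies in the Jacobian ideal resolves the torsor at the next closed point (Theses-free, def-free)

OURS (campaign `res-hironaka`, rung L ★L-G4, slot W4.1; res-L0-w41-idea-3's card `hyperbolic-splitting-p2` v3 piece (C8)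
`lowSurfaceStepExits` «a surface step of the LOW tower EXITS»; res-L0-w41-plan-1 RULING 20a «072's objects NOW: C8»; res-L0-w41-strat-2
§σ2.23 `LowSurfaceStepExitsTwo` (PROPOSED CUT, `Steer_r27_plus_s23.lean` l.3537–3560; per RULING 21b(iii) the statement posted by this seat,
HOME/STATUS 2026-08-27T09:01:08Z, governs: the LOW-SHAPE-WITH-DUALS presentation of the tree's C2/C3/C5/C7 replaces `(g z w, hlow, hder)`).
Replaces the role of no printed item; NOT a statement of the manuscript under review [claim: Hironaka2017, status: under-review]; AI review is
weaker than expert review.)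

## What is proved

ENGINE = res-L0-w41-lead-1's `Theorems/FrobeniusClosingSteerBlowupDerivation.lean` (p515974,
`BlowupDerivation.exists_derivation_smul_localBlowupAlong`: for `x ∈ I` the derivation `x • δ` of `R` extends to the local blowing up of `R`
along ANY finitely generated centre `I` — the positive-dimensional twin of H4), imported by name.

This file (namespace `…Theorems.SwitchingDichotomy.CriticalSurface`):
* `surfaceStep_not_mem_sq` — characteristic `2`, one step `R ⊆ R'` of a torsor run along a centre `P` (`IsLocalBlowupAlong O R P R'`,
  strict step `s = x·s' + g` with `x ∈ P`): **if the exceptional parameter `x` lies in the `R`-span of `D₁(s²), D₂(s²)` for two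
  derivations `D₁, D₂` of `R`, then NO cleaning `s'² − γ²` lies in `𝔪_{R'}²`** — the torsor `T² = s'²` is regular at the closed point of
  `R'` (res-type-082's criterion), the run EXITS. Proof: `D_j' ⊇ x • D_j` on `R'` (lead-1's engine) and the tree's one-step Jacobian law
  `SteerRankThinness.jacobianStepLaw` (`D_j(s²) = x · D_j'(s'²)`) turn `x = r₁ D₁(s²) + r₂ D₂(s²)` into `1 = r₁ D₁'(s'²) + r₂ D₂'(s'²)` in
  the local ring `R'`; derivations kill squares and map `𝔪'²` into `𝔪'`, so a cleaning into `𝔪'²` would put `1` in `𝔪'`.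
* `exists_cleaning_of_sigmaTop` — bookkeeping: a σ_top centre at `(R', f')` (the skeleton's `IsSigmaTopCentre` UNFOLDED, either disjunct)
  yields a cleaning `f' − γ² ∈ 𝔪'²`.
* **`lowSurfaceStep_height_eq_three`** (C8, run level = strat-2's `LowSurfaceStepExitsTwo` in the posted cut): at a LOW-SHAPE stage
  `s² − g² = l₁ l₂ + c` (`c ∈ 𝔪³`, `(l₁, …, l₄) = 𝔪`, dual derivations `D₁, D₂`) of a 2-steered run over a regular local `R` of dimension
  `4`, whose σ_top centre `P` is NOT the closed point, and whose next stage again carries a σ_top centre, **`P` is a CURVE: `ht P = 3`.**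
  Proof: `P` is permissible, hence a singular prime `≠ 𝔪`; by C1 (`derivation_apply_mem_of_singular`, p511593) `D₁(s²), D₂(s²) ∈ P`, so
  `P ⊇ P₀ = (D₁(s²), D₂(s²))`, a prime of height `2` (C2 `criticalSurface`); if `P = P₀` (a SURFACE step) the exceptional parameter lies in
  `P₀` and `surfaceStep_not_mem_sq` contradicts the cleaning at the next stage; so `P₀ < P < 𝔪` and `ht P = 3`.

Consumers: strat-2's §σ2.24 glue `lowRunTamedMixedBranchTwo_of_pieces` (C8 slot) / res-D-pv-012's D3a tower moves («surface step
impossible»). [cite: Matsumura1987, Thm. 14.2] [folklore]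
-/

noncomputable section

-- `Summit.<S>.<S>.…` duplicates the summit name by design (single-problem summit).
set_option linter.dupNamespace false

open Polynomial IsLocalRing Literature.AlgebraicGeometry.Resolution

/-! ## A step whose exceptional parameter lies in the Jacobian ideal exits; C8 at run level -/

namespace Summit.ResolutionOfSingularities.ResolutionOfSingularities.Theorems.SwitchingDichotomy.CriticalSurface

open Summit.ResolutionOfSingularities.ResolutionOfSingularities.Theorems.SwitchingDichotomy

variable {K : Type} [Field K]

/-- **A step with exceptional parameter in the Jacobian span EXITS** (characteristic `2`). Let `R'` be the local blowing up of `R ⊆ K`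
along the centre `P` with respect to `O`, `R'` local, `s = x·s' + g` a strict step of radicands (`s² ∈ R`, `s'² ∈ R'`, `g ∈ R`) with
`0 ≠ x ∈ P`, and `D₁, D₂ ∈ Der_ℤ(R)`. If `x` lies in the `R`-span of `D₁(s²), D₂(s²)`, then no cleaning `s'² − γ²` (`γ ∈ R'`) lies in
`𝔪_{R'}²` — by res-type-082's criterion the torsor `T² = s'²` is regular at the closed point of `R'`. (For the critical-surface centre
`P = (D₁(s²), D₂(s²))` of a LOW stage the hypothesis holds for every exceptional parameter.) OURS. [cite: Matsumura1987, Thm. 14.2] [folklore] -/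
theorem surfaceStep_not_mem_sq [CharP K 2] (O : ValuationSubring K) (R R' : Subring K) [IsLocalRing R'] (P : Ideal R)
    (hbl : IsLocalBlowupAlong O R P R') (x : K) (hxR : x ∈ R) (hxP : (⟨x, hxR⟩ : R) ∈ P) (hx0 : x ≠ 0)
    (s s' g : K) (hg : g ∈ R) (hstep : s = x * s' + g) (hs : s ^ 2 ∈ R) (hs' : s' ^ 2 ∈ R')
    (D₁ D₂ : Derivation ℤ R R)
    (hxJ : (⟨x, hxR⟩ : R) ∈ Ideal.span {D₁ ⟨s ^ 2, hs⟩, D₂ ⟨s ^ 2, hs⟩}) :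
    ∀ γ : R', (⟨s' ^ 2, hs'⟩ : R') - γ ^ 2 ∉ maximalIdeal R' ^ 2 := by
  classical
  haveI : Fact (Nat.Prime 2) := ⟨Nat.prime_two⟩
  have hle : R ≤ R' := hbl.isLocalBlowup.le
  -- the transported derivations `D_j' ⊇ x • D_j`
  obtain ⟨D₁', hD₁'⟩ :=
    BlowupDerivation.exists_derivation_smul_localBlowupAlong O R R' P hbl ⟨x, hxR⟩ hxP D₁
  obtain ⟨D₂', hD₂'⟩ :=
    BlowupDerivation.exists_derivation_smul_localBlowupAlong O R R' P hbl ⟨x, hxR⟩ hxP D₂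
  have hD₁K : ∀ a : R, ((D₁' (Subring.inclusion hle a) : R') : K) = x * ((D₁ a : R) : K) := fun a => by
    rw [hD₁' a]; rfl
  have hD₂K : ∀ a : R, ((D₂' (Subring.inclusion hle a) : R') : K) = x * ((D₂ a : R) : K) := fun a => by
    rw [hD₂' a]; rfl
  -- the one-step Jacobian law at `p = 2`: `D_j(s²) = x · D_j'(s'²)`
  set f : R := ⟨s ^ 2, hs⟩ with hfdef
  set f' : R' := ⟨s' ^ 2, hs'⟩ with hf'def
  have hlaw₁ : ((D₁ f : R) : K) = x * ((D₁' f' : R') : K) := by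
    have h := SteerRankThinness.jacobianStepLaw (K := K) 2 hle x hxR hx0 D₁ D₁' hD₁K s s' g hg hstep hs hs'
    simpa using h
  have hlaw₂ : ((D₂ f : R) : K) = x * ((D₂' f' : R') : K) := by
    have h := SteerRankThinness.jacobianStepLaw (K := K) 2 hle x hxR hx0 D₂ D₂' hD₂K s s' g hg hstep hs hs'
    simpa using h
  -- `x = r₁ D₁ f + r₂ D₂ f` gives `1 = r₁ D₁' f' + r₂ D₂' f'` in `R'`
  obtain ⟨r₁, r₂, hr⟩ := Ideal.mem_span_pair.mp hxJ
  have hone : (1 : R') = Subring.inclusion hle r₁ * D₁' f' + Subring.inclusion hle r₂ * D₂' f' := by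
    apply Subtype.ext
    have hrK : (r₁ : K) * ((D₁ f : R) : K) + (r₂ : K) * ((D₂ f : R) : K) = x := by
      have := congrArg (fun z : R => (z : K)) hr
      simpa using this
    rw [hlaw₁, hlaw₂] at hrK
    apply mul_left_cancel₀ hx0
    show x * (1 : K) = x * ((Subring.inclusion hle r₁ * D₁' f' + Subring.inclusion hle r₂ * D₂' f' : R') : K)
    push_cast
    show x * (1 : K) = x * ((r₁ : K) * ((D₁' f' : R') : K) + (r₂ : K) * ((D₂' f' : R') : K))
    linear_combination -hrK
  -- a cleaning into `𝔪'²` would put `1` in `𝔪'`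
  intro γ hγ
  have hb₁ : D₁' f' ∈ maximalIdeal R' := by
    have h := derivation_apply_mem_of_mem_sq D₁' _ hγ
    rwa [map_sub, derivation_apply_sq, sub_zero] at h
  have hb₂ : D₂' f' ∈ maximalIdeal R' := by
    have h := derivation_apply_mem_of_mem_sq D₂' _ hγ
    rwa [map_sub, derivation_apply_sq, sub_zero] at h
  have h1 : (1 : R') ∈ maximalIdeal R' := by
    rw [hone]
    exact add_mem (Ideal.mul_mem_left _ _ hb₁) (Ideal.mul_mem_left _ _ hb₂)
  exact (maximalIdeal.isMaximal R').ne_top ((Ideal.eq_top_iff_one _).mpr h1)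

/-- Bookkeeping: a σ_top centre `P'` at `(R', f')` — the skeleton's `IsSigmaTopCentre R' 2 f' P'` UNFOLDED (either a permissible centre,
which carries a global cleaner `f' − γ² ∈ P'² ⊆ 𝔪'²`, or the point step with `f' − γ² ∈ 𝔪'²`) — yields a cleaning of `f'` into `𝔪'²`.
[folklore] -/
theorem exists_cleaning_of_sigmaTop (R' : Subring K) [IsLocalRing R'] (f' : R') (P' : Ideal R')
    (hσ' : (P' ≠ maximalIdeal R' ∧
          (∃ _ : P'.IsPrime,
            ¬ IsRegularLocalRing
                (AdjoinRoot (Polynomial.X ^ 2 - Polynomial.C (algebraMap R' (Localization.AtPrime P') f'))) ∧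
              (∀ (Q' : Ideal R') [Q'.IsPrime],
                ¬ IsRegularLocalRing
                    (AdjoinRoot (Polynomial.X ^ 2 -
                      Polynomial.C (algebraMap R' (Localization.AtPrime Q') f'))) →
                  Q' ≤ P' → Q' = P') ∧
              (∀ (Q' : Ideal R') [Q'.IsPrime],
                ¬ IsRegularLocalRing
                    (AdjoinRoot (Polynomial.X ^ 2 -
                      Polynomial.C (algebraMap R' (Localization.AtPrime Q') f'))) →
                  (∀ (Q'' : Ideal R') [Q''.IsPrime],
                    ¬ IsRegularLocalRing
                        (AdjoinRoot (Polynomial.X ^ 2 -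
                          Polynomial.C (algebraMap R' (Localization.AtPrime Q'') f'))) →
                      Q'' ≤ Q' → Q'' = Q') →
                  ringKrullDim (R' ⧸ Q') ≤ ringKrullDim (R' ⧸ P'))) ∧
          IsRegularLocalRing (R' ⧸ P') ∧ ∃ g : R', f' - g ^ 2 ∈ P' ^ 2) ∨
        (P' = maximalIdeal R' ∧
          (∀ Q : Ideal R',
            ¬ (Q ≠ maximalIdeal R' ∧
                (∃ _ : Q.IsPrime,
                  ¬ IsRegularLocalRing
                      (AdjoinRoot (Polynomial.X ^ 2 - Polynomial.C (algebraMap R' (Localization.AtPrime Q) f'))) ∧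
                    (∀ (Q' : Ideal R') [Q'.IsPrime],
                      ¬ IsRegularLocalRing
                          (AdjoinRoot (Polynomial.X ^ 2 -
                            Polynomial.C (algebraMap R' (Localization.AtPrime Q') f'))) →
                        Q' ≤ Q → Q' = Q) ∧
                    (∀ (Q' : Ideal R') [Q'.IsPrime],
                      ¬ IsRegularLocalRing
                          (AdjoinRoot (Polynomial.X ^ 2 -
                            Polynomial.C (algebraMap R' (Localization.AtPrime Q') f'))) →
                        (∀ (Q'' : Ideal R') [Q''.IsPrime],
                          ¬ IsRegularLocalRing
                              (AdjoinRoot (Polynomial.X ^ 2 -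
                                Polynomial.C (algebraMap R' (Localization.AtPrime Q'') f'))) →
                            Q'' ≤ Q' → Q'' = Q') →
                        ringKrullDim (R' ⧸ Q') ≤ ringKrullDim (R' ⧸ Q))) ∧
                IsRegularLocalRing (R' ⧸ Q) ∧ ∃ g : R', f' - g ^ 2 ∈ Q ^ 2)) ∧
          ∃ g : R', f' - g ^ 2 ∈ maximalIdeal R' ^ 2)) :
    ∃ γ : R', f' - γ ^ 2 ∈ maximalIdeal R' ^ 2 := by
  rcases hσ' with ⟨hne, ⟨hprime, -⟩, -, γ, hγ⟩ | ⟨-, -, γ, hγ⟩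
  · haveI := hprime
    exact ⟨γ, Ideal.pow_right_mono (IsLocalRing.le_maximalIdeal (Ideal.IsPrime.ne_top inferInstance)) 2 hγ⟩
  · exact ⟨γ, hγ⟩

/-- **(C8) A surface step is impossible on the LOW tower: a positive-dimensional σ_top centre at a LOW-shape stage is a CURVE.**
Characteristic `2`; `R ⊆ K` regular local of dimension `4`, `f = s²` in low shape `s² − g² = l₁ l₂ + c` (`c ∈ 𝔪³`, `(l₁, l₂, l₃, l₄) = 𝔪`,
`D₁, D₂ ∈ Der_ℤ(R)` dual to `l₁, l₂`); `P` the σ_top centre at `(R, f)` (the skeleton's `IsSigmaTopCentre R 2 f P` UNFOLDED), not the closed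
point; `R'` the local blowing up of `R` along `P` with respect to `O`, `s = x·s' + g₀` the strict step with `x` an exceptional parameter
along `P` (`IsStrictStepAlong` UNFOLDED), `R'` local; and the next stage CLEANABLE (`s'² − γ² ∈ 𝔪_{R'}²` for some `γ`, e.g. from a σ_top
centre at `R'` via `exists_cleaning_of_sigmaTop`). Then `ht P = 3`. Indeed `P` is a singular prime, so `P ⊇ P₀ = (D₁ f, D₂ f)` (C1), a prime
of height `2` (C2); `P = P₀` would be a SURFACE step, where `surfaceStep_not_mem_sq` forbids the cleaning; hence `P₀ < P < 𝔪`. OURS.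
[cite: Matsumura1987, Thm. 14.2] [folklore] -/
theorem lowSurfaceStep_height_eq_three [CharP K 2] (O : ValuationSubring K) (R R' : Subring K) [IsRegularLocalRing R]
    [IsLocalRing R'] (hdim : ringKrullDim R = 4)
    (s s' : K) (hs : s ^ 2 ∈ R) (hs' : s' ^ 2 ∈ R')
    (g l₁ l₂ l₃ l₄ c : R) (hf : (⟨s ^ 2, hs⟩ : R) - g ^ 2 = l₁ * l₂ + c) (hc : c ∈ maximalIdeal R ^ 3)
    (hspan : Ideal.span {l₁, l₂, l₃, l₄} = maximalIdeal R)
    (D₁ D₂ : Derivation ℤ R R) (h11 : D₁ l₁ = 1) (h12 : D₁ l₂ = 0) (h21 : D₂ l₁ = 0) (h22 : D₂ l₂ = 1)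
    (P : Ideal R)
    (hσ : (P ≠ maximalIdeal R ∧
          (∃ _ : P.IsPrime,
            ¬ IsRegularLocalRing
                (AdjoinRoot (Polynomial.X ^ 2 -
                  Polynomial.C (algebraMap R (Localization.AtPrime P) (⟨s ^ 2, hs⟩ : R)))) ∧
              (∀ (Q' : Ideal R) [Q'.IsPrime],
                ¬ IsRegularLocalRing
                    (AdjoinRoot (Polynomial.X ^ 2 -
                      Polynomial.C (algebraMap R (Localization.AtPrime Q') (⟨s ^ 2, hs⟩ : R)))) →
                  Q' ≤ P → Q' = P) ∧
              (∀ (Q' : Ideal R) [Q'.IsPrime],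
                ¬ IsRegularLocalRing
                    (AdjoinRoot (Polynomial.X ^ 2 -
                      Polynomial.C (algebraMap R (Localization.AtPrime Q') (⟨s ^ 2, hs⟩ : R)))) →
                  (∀ (Q'' : Ideal R) [Q''.IsPrime],
                    ¬ IsRegularLocalRing
                        (AdjoinRoot (Polynomial.X ^ 2 -
                          Polynomial.C (algebraMap R (Localization.AtPrime Q'') (⟨s ^ 2, hs⟩ : R)))) →
                      Q'' ≤ Q' → Q'' = Q') →
                  ringKrullDim (R ⧸ Q') ≤ ringKrullDim (R ⧸ P))) ∧
          IsRegularLocalRing (R ⧸ P) ∧ ∃ g : R, (⟨s ^ 2, hs⟩ : R) - g ^ 2 ∈ P ^ 2) ∨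
        (P = maximalIdeal R ∧
          (∀ Q : Ideal R,
            ¬ (Q ≠ maximalIdeal R ∧
                (∃ _ : Q.IsPrime,
                  ¬ IsRegularLocalRing
                      (AdjoinRoot (Polynomial.X ^ 2 -
                        Polynomial.C (algebraMap R (Localization.AtPrime Q) (⟨s ^ 2, hs⟩ : R)))) ∧
                    (∀ (Q' : Ideal R) [Q'.IsPrime],
                      ¬ IsRegularLocalRing
                          (AdjoinRoot (Polynomial.X ^ 2 -
                            Polynomial.C (algebraMap R (Localization.AtPrime Q') (⟨s ^ 2, hs⟩ : R)))) →
                        Q' ≤ Q → Q' = Q) ∧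
                    (∀ (Q' : Ideal R) [Q'.IsPrime],
                      ¬ IsRegularLocalRing
                          (AdjoinRoot (Polynomial.X ^ 2 -
                            Polynomial.C (algebraMap R (Localization.AtPrime Q') (⟨s ^ 2, hs⟩ : R)))) →
                        (∀ (Q'' : Ideal R) [Q''.IsPrime],
                          ¬ IsRegularLocalRing
                              (AdjoinRoot (Polynomial.X ^ 2 -
                                Polynomial.C (algebraMap R (Localization.AtPrime Q'') (⟨s ^ 2, hs⟩ : R)))) →
                            Q'' ≤ Q' → Q'' = Q') →
                        ringKrullDim (R ⧸ Q') ≤ ringKrullDim (R ⧸ Q))) ∧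
                IsRegularLocalRing (R ⧸ Q) ∧ ∃ g : R, (⟨s ^ 2, hs⟩ : R) - g ^ 2 ∈ Q ^ 2)) ∧
          ∃ g : R, (⟨s ^ 2, hs⟩ : R) - g ^ 2 ∈ maximalIdeal R ^ 2))
    (hP : P ≠ maximalIdeal R)
    (hbl : IsLocalBlowupAlong O R P R')
    (hstrict : ∃ x g₀ : K, ((∃ hx : x ∈ R, (⟨x, hx⟩ : R) ∈ P) ∧ x ≠ 0 ∧
        ∀ y : R, y ∈ P → O.valuation (y : K) ≤ O.valuation x) ∧ g₀ ∈ R ∧ s = x * s' + g₀)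
    (hclean' : ∃ γ : R', (⟨s' ^ 2, hs'⟩ : R') - γ ^ 2 ∈ maximalIdeal R' ^ 2) :
    P.height = 3 := by
  classical
  haveI : CharP R 2 := inferInstance
  set f : R := ⟨s ^ 2, hs⟩ with hfdef
  -- `P` is a permissible centre: a singular prime `≠ 𝔪`
  rcases hσ with ⟨-, ⟨hPprime, hsing, -, -⟩, -, -⟩ | ⟨hPm, -, -⟩
  swap
  · exact absurd hPm hP
  haveI := hPprime
  -- (C1) the Jacobian pair lies in `P`
  have h₁ : D₁ f ∈ P := derivation_apply_mem_of_singular R f P hsing D₁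
  have h₂ : D₂ f ∈ P := derivation_apply_mem_of_singular R f P hsing D₂
  -- (C2) `P₀ = (D₁ f, D₂ f)` is a prime of height `2`
  have hdim4 : ringKrullDim R = (4 : ℕ) := by rw [hdim]; norm_cast
  obtain ⟨hP0prime, hP0ht, -, -⟩ := criticalSurface hdim4 f g l₁ l₂ l₃ l₄ c hf hc hspan D₁ D₂ h11 h12 h21 h22
  set P₀ : Ideal R := Ideal.span {D₁ f, D₂ f} with hP₀
  have hle : P₀ ≤ P := by
    rw [hP₀, Ideal.span_le]
    simp only [Set.insert_subset_iff, Set.singleton_subset_iff, SetLike.mem_coe]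
    exact ⟨h₁, h₂⟩
  rcases eq_or_lt_of_le hle with heq | hlt
  · -- a SURFACE step: the next stage would be regular at its closed point
    exfalso
    obtain ⟨x, g₀, ⟨⟨hxR, hxP⟩, hx0, -⟩, hg₀, hstep⟩ := hstrict
    have hxJ : (⟨x, hxR⟩ : R) ∈ Ideal.span {D₁ f, D₂ f} := by rw [← hP₀, heq]; exact hxP
    obtain ⟨γ, hγ⟩ := hclean'
    exact surfaceStep_not_mem_sq O R R' P hbl x hxR hxP hx0 s s' g₀ hg₀ hstep hs hs' D₁ D₂ hxJ γ hγ
  · -- `2 < ht P < 4`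
    haveI := hP0prime
    have hgt : (2 : ℕ∞) < P.height := by
      rw [← hP0ht]
      exact Ideal.height_strict_mono_of_isPrime_of_isPrime hlt
    have hlt4 : P.height < (4 : ℕ) := by
      have hm : (maximalIdeal R).height = (4 : ℕ) := by
        have h := IsLocalRing.maximalIdeal_height_eq_ringKrullDim (R := R)
        rw [hdim4, ← WithBot.coe_natCast, WithBot.coe_eq_coe] at h
        exact h
      rw [← hm]
      exact Ideal.height_strict_mono_of_isPrime_of_isPrime
        (lt_of_le_of_ne (IsLocalRing.le_maximalIdeal (Ideal.IsPrime.ne_top inferInstance)) hP)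
    have hfin : P.height ≠ ⊤ := ne_top_of_lt hlt4
    obtain ⟨n, hn⟩ := ENat.ne_top_iff_exists.mp hfin
    rw [← hn] at hgt hlt4 ⊢
    have h2 : 2 < n := by exact_mod_cast hgt
    have h4 : n < 4 := by exact_mod_cast hlt4
    have h3 : n = 3 := by omega
    rw [h3]; rfl

end Summit.ResolutionOfSingularities.ResolutionOfSingularities.Theorems.SwitchingDichotomy.CriticalSurface

end
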